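import Summits.ValiantsHypothesis.ValiantsHypothesis.Theorems.BarrierLeverTransversalMinorLayoutsRankFive

/-!
# Route BarrierLever — conjecture TT (`TransversalMinorLayoutsNonsingular`, stmt-ValiantsHypothesis-19152):
# complexes using every coordinate with one or two extra faces (claws)

Helper file (`--supports stmt-ValiantsHypothesis-19152`; cell valiant-natproofs, rung V4, 𝒟-side of
door (c); seat val-np-p1 gen 8).  Combinatorics for the locked cells of the bounded engine
(`FiniteCheck.tt_rank_le_of_lockedCore`): a LOCKED pair of complexes (injective lower-set layouts)
has a side using every coordinate (`full_or_full_of_locked`), and a complex with `r` faces using all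
`h` coordinates contains the `h + 1` faces `∅`, `{a}` (`claw_subset_image`); hence

* `r = h + 1` (CLAW): every face has at most one element and every coordinate has degree `1`
  (`face_card_le_one_of_claw`, `degree_eq_one_of_claw`);
* `r = h + 2 < 8` (CLAW PLUS AN EDGE): the faces are `∅`, the singletons and one pair
  (`image_eq_of_claw_edge`); for `h ≥ 3` some coordinate has degree `2` and some has degree `1`
  (`exists_degree_two_one_of_claw_edge`);
* `r = h + 3 < 8` (CLAW PLUS TWO EDGES): the faces are `∅`, the singletons and two distinct pairs
  (`image_eq_of_claw_two_edges`).

WHAT THIS IS NOT: bookkeeping for bounded-rank slices of TT; nothing on TT / item 19761 in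
general, on crux stmt-ValiantsHypothesis-14610, or on `VP` versus `VNP`.
-/

-- layout Summits/ValiantsHypothesis/ValiantsHypothesis forces the duplicated namespace component
set_option linter.dupNamespace false

open Matrix Finset

namespace Summit.ValiantsHypothesis.ValiantsHypothesis.Theorems.BarrierLever.FiniteCheck

open Summit.ValiantsHypothesis.ValiantsHypothesis.Theorems.BarrierLever.Compression
open Summit.ValiantsHypothesis.ValiantsHypothesis.Theorems.BarrierLever.PriorityPeeling

/-! ## 2. Full-support complexes with one or two extra faces -/

/-- The faces `∅` and `{a}` (all `a`) of a complex using every coordinate: `h + 1` distinct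
members. -/
theorem claw_subset_image {h r : ℕ} (u : Fin r → Finset (Fin h)) (hl : IsLowerSet (Set.range u))
    (hfull : ∀ a : Fin h, ∃ i, a ∈ u i) (hr : 0 < r) :
    insert (∅ : Finset (Fin h)) (Finset.univ.image fun a : Fin h => ({a} : Finset (Fin h))) ⊆
      Finset.univ.image u ∧
    (insert (∅ : Finset (Fin h))
      (Finset.univ.image fun a : Fin h => ({a} : Finset (Fin h)))).card = h + 1 := by
  classical
  constructor
  · intro x hx
    rw [Finset.mem_insert, Finset.mem_image] at hx
    rcases hx with rfl | ⟨a, _, rfl⟩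
    · obtain ⟨i, hi⟩ := hl (show (∅ : Finset (Fin h)) ≤ u ⟨0, hr⟩ from Finset.empty_subset _)
        ⟨⟨0, hr⟩, rfl⟩
      exact Finset.mem_image.mpr ⟨i, Finset.mem_univ _, hi⟩
    · obtain ⟨i, hai⟩ := hfull a
      obtain ⟨j, hj⟩ := hl (show ({a} : Finset (Fin h)) ≤ u i from
        Finset.singleton_subset_iff.mpr hai) ⟨i, rfl⟩
      exact Finset.mem_image.mpr ⟨j, Finset.mem_univ _, hj⟩
  · rw [Finset.card_insert_of_notMem, Finset.card_image_of_injective _ Finset.singleton_injective,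
      Finset.card_univ, Fintype.card_fin]
    rw [Finset.mem_image]
    rintro ⟨a, _, ha⟩
    exact Finset.singleton_ne_empty a ha

/-- CLAW: a complex with `h + 1` faces using all `h` coordinates consists of `∅` and the vertices;
every coordinate then lies in exactly one face. -/
theorem degree_eq_one_of_claw {h r : ℕ} (u : Fin r → Finset (Fin h)) (hu : Function.Injective u)
    (hl : IsLowerSet (Set.range u)) (hfull : ∀ a : Fin h, ∃ i, a ∈ u i) (hr : r = h + 1)
    (a : Fin h) : (Finset.univ.filter fun i => a ∈ u i).card = 1 := by
  classical
  obtain ⟨hsub, hcard⟩ := claw_subset_image u hl hfull (by omega)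
  have himg : (Finset.univ.image u).card = r := by
    rw [Finset.card_image_of_injective _ hu, Finset.card_univ, Fintype.card_fin]
  have heq := Finset.eq_of_subset_of_card_le hsub (by rw [himg, hcard, hr])
  -- every face has at most one element
  have hle1 : ∀ i, (u i).card ≤ 1 := by
    intro i
    have hi : u i ∈ Finset.univ.image u := Finset.mem_image.mpr ⟨i, Finset.mem_univ _, rfl⟩
    rw [← heq, Finset.mem_insert, Finset.mem_image] at hi
    rcases hi with e | ⟨b, _, e⟩
    · rw [e]; simp
    · rw [← e]; simp
  obtain ⟨i₀, hi₀⟩ := hfull a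
  rw [Finset.card_eq_one]
  refine ⟨i₀, Finset.eq_singleton_iff_unique_mem.mpr ⟨by simpa using hi₀, fun i hi => ?_⟩⟩
  rw [Finset.mem_filter] at hi
  apply hu
  rw [Finset.card_le_one.mp (hle1 i) |> fun H => Finset.eq_singleton_iff_unique_mem.mpr
      ⟨hi.2, fun b hb => H b hb a hi.2⟩,
    Finset.eq_singleton_iff_unique_mem.mpr ⟨hi₀, fun b hb => Finset.card_le_one.mp (hle1 i₀) b hb a hi₀⟩]

/-- CLAW PLUS AN EDGE, structure: a complex with `h + 2 < 8` faces using all `h` coordinates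
consists of `∅`, the singletons and ONE pair `{p, q}`. -/
theorem image_eq_of_claw_edge {h r : ℕ} (u : Fin r → Finset (Fin h))
    (hu : Function.Injective u) (hl : IsLowerSet (Set.range u)) (hfull : ∀ a : Fin h, ∃ i, a ∈ u i)
    (hr : r = h + 2) (hr8 : r < 8) :
    ∃ p q : Fin h, p ≠ q ∧ Finset.univ.image u = insert ({p, q} : Finset (Fin h))
      (insert (∅ : Finset (Fin h)) (Finset.univ.image fun a : Fin h => ({a} : Finset (Fin h)))) := by
  classical
  obtain ⟨hsub, hcard⟩ := claw_subset_image u hl hfull (by omega)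
  set S := insert (∅ : Finset (Fin h))
    (Finset.univ.image fun a : Fin h => ({a} : Finset (Fin h))) with hSdef
  have himg : (Finset.univ.image u).card = r := by
    rw [Finset.card_image_of_injective _ hu, Finset.card_univ, Fintype.card_fin]
  -- the extra face
  obtain ⟨f, hf⟩ : ∃ f, f ∈ Finset.univ.image u \ S := by
    apply Finset.Nonempty.exists_mem
    rw [← Finset.card_pos, Finset.card_sdiff_of_subset hsub, himg, hcard, hr]
    omega
  rw [Finset.mem_sdiff] at hf
  obtain ⟨hfu, hfS⟩ := hf
  have heq : Finset.univ.image u = insert f S := by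
    symm
    apply Finset.eq_of_subset_of_card_le (Finset.insert_subset hfu hsub)
    rw [Finset.card_insert_of_notMem hfS, hcard, himg, hr]
  -- it is an edge `{p, q}`
  have hlow : ∀ x ∈ Finset.univ.image u, ∀ t, t ⊆ x → t ∈ Finset.univ.image u := by
    intro x hx t ht
    obtain ⟨i, _, rfl⟩ := Finset.mem_image.mp hx
    obtain ⟨j, hj⟩ := hl ht ⟨i, rfl⟩
    exact Finset.mem_image.mpr ⟨j, Finset.mem_univ _, hj⟩
  have hf2 : f.card = 2 := by
    have hle := card_le_two_of_mem_lowerFamily _ hlow (by omega) f hfu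
    rcases Nat.lt_or_ge f.card 2 with hlt | hge
    · exfalso
      apply hfS
      rcases Nat.lt_or_ge f.card 1 with h0 | h1
      · rw [Finset.card_eq_zero.mp (show f.card = 0 by omega), hSdef]
        exact Finset.mem_insert_self _ _
      · obtain ⟨a, rfl⟩ := Finset.card_eq_one.mp (show f.card = 1 by omega)
        rw [hSdef, Finset.mem_insert, Finset.mem_image]
        exact Or.inr ⟨a, Finset.mem_univ _, rfl⟩
    · omega
  obtain ⟨p, q, hpq, rfl⟩ := Finset.card_eq_two.mp hf2
  exact ⟨p, q, hpq, heq⟩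

/-- CLAW PLUS AN EDGE, degrees: with `h ≥ 3` some coordinate lies in exactly two faces (an
endpoint of the edge) and some coordinate lies in exactly one face (a vertex off the edge). -/
theorem exists_degree_two_one_of_claw_edge {h r : ℕ} (u : Fin r → Finset (Fin h))
    (hu : Function.Injective u) (hl : IsLowerSet (Set.range u)) (hfull : ∀ a : Fin h, ∃ i, a ∈ u i)
    (hr : r = h + 2) (hr8 : r < 8) (h3 : 3 ≤ h) :
    ∃ p x : Fin h, (Finset.univ.filter fun i => p ∈ u i).card = 2 ∧
      (Finset.univ.filter fun i => x ∈ u i).card = 1 := by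
  classical
  obtain ⟨p, q, hpq, heq⟩ := image_eq_of_claw_edge u hu hl hfull hr hr8
  set S := insert (∅ : Finset (Fin h))
    (Finset.univ.image fun a : Fin h => ({a} : Finset (Fin h))) with hSdef
  -- named faces are members
  have hmem : ∀ t, t ∈ insert ({p, q} : Finset (Fin h)) S → ∃ i, u i = t := by
    intro t ht
    rw [← heq] at ht
    obtain ⟨i, _, hi⟩ := Finset.mem_image.mp ht
    exact ⟨i, hi⟩
  have hsing : ∀ a : Fin h, ({a} : Finset (Fin h)) ∈ insert ({p, q} : Finset (Fin h)) S := by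
    intro a
    rw [Finset.mem_insert, hSdef, Finset.mem_insert, Finset.mem_image]
    exact Or.inr (Or.inr ⟨a, Finset.mem_univ _, rfl⟩)
  -- which faces contain a given coordinate
  have hfaces : ∀ i (x : Fin h), x ∈ u i → u i = {p, q} ∨ u i = {x} := by
    intro i x hxi
    have hi : u i ∈ insert ({p, q} : Finset (Fin h)) S := by
      rw [← heq]; exact Finset.mem_image.mpr ⟨i, Finset.mem_univ _, rfl⟩
    rw [Finset.mem_insert, hSdef, Finset.mem_insert, Finset.mem_image] at hi
    rcases hi with e | e | ⟨b, _, e⟩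
    · exact Or.inl e
    · rw [e] at hxi; simp at hxi
    · rw [← e, Finset.mem_singleton] at hxi
      subst hxi
      exact Or.inr e.symm
  -- a vertex off the edge
  obtain ⟨x, hx⟩ : ∃ x : Fin h, x ∉ ({p, q} : Finset (Fin h)) := by
    by_contra hno
    push Not at hno
    have : (Finset.univ : Finset (Fin h)) ⊆ {p, q} := fun x _ => hno x
    have := Finset.card_le_card this
    rw [Finset.card_univ, Fintype.card_fin, Finset.card_pair hpq] at this
    omega
  obtain ⟨ix, hix⟩ := hmem {x} (hsing x)
  obtain ⟨ip, hip⟩ := hmem {p} (hsing p)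
  obtain ⟨ie, hie⟩ := hmem {p, q} (Finset.mem_insert_self _ _)
  have hne : ip ≠ ie := by
    intro e
    rw [e, hie] at hip
    have : q ∈ ({p} : Finset (Fin h)) := by rw [← hip]; simp
    exact hpq (Finset.mem_singleton.mp this).symm
  refine ⟨p, x, ?_, ?_⟩
  · have hfil : (Finset.univ.filter fun i => p ∈ u i) = {ip, ie} := by
      ext i
      simp only [Finset.mem_filter, Finset.mem_univ, true_and, Finset.mem_insert,
        Finset.mem_singleton]
      constructor
      · intro hpi
        rcases hfaces i p hpi with e | e
        · exact Or.inr (hu (by rw [e, hie]))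
        · exact Or.inl (hu (by rw [e, hip]))
      · rintro (rfl | rfl)
        · rw [hip]; simp
        · rw [hie]; simp
    rw [hfil, Finset.card_pair hne]
  · have hfil : (Finset.univ.filter fun i => x ∈ u i) = {ix} := by
      ext i
      simp only [Finset.mem_filter, Finset.mem_univ, true_and, Finset.mem_singleton]
      constructor
      · intro hxi
        rcases hfaces i x hxi with e | e
        · rw [e] at hxi; exact absurd hxi hx
        · exact hu (by rw [e, hix])
      · rintro rfl
        rw [hix]; simp
    rw [hfil, Finset.card_singleton]

/-- CLAW PLUS TWO EDGES, structure: a complex with `h + 3 < 8` faces using all `h` coordinates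
consists of `∅`, the singletons and TWO distinct pairs. -/
theorem image_eq_of_claw_two_edges {h r : ℕ} (u : Fin r → Finset (Fin h))
    (hu : Function.Injective u) (hl : IsLowerSet (Set.range u)) (hfull : ∀ a : Fin h, ∃ i, a ∈ u i)
    (hr : r = h + 3) (hr8 : r < 8) :
    ∃ e₁ e₂ : Finset (Fin h), e₁ ≠ e₂ ∧ e₁.card = 2 ∧ e₂.card = 2 ∧
      Finset.univ.image u = insert e₁ (insert e₂
        (insert (∅ : Finset (Fin h)) (Finset.univ.image fun a : Fin h => ({a} : Finset (Fin h))))) := by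
  classical
  obtain ⟨hsub, hcard⟩ := claw_subset_image u hl hfull (by omega)
  set S := insert (∅ : Finset (Fin h))
    (Finset.univ.image fun a : Fin h => ({a} : Finset (Fin h))) with hSdef
  have himg : (Finset.univ.image u).card = r := by
    rw [Finset.card_image_of_injective _ hu, Finset.card_univ, Fintype.card_fin]
  have hlow : ∀ x ∈ Finset.univ.image u, ∀ t, t ⊆ x → t ∈ Finset.univ.image u := by
    intro x hx t ht
    obtain ⟨i, _, rfl⟩ := Finset.mem_image.mp hx
    obtain ⟨j, hj⟩ := hl ht ⟨i, rfl⟩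
    exact Finset.mem_image.mpr ⟨j, Finset.mem_univ _, hj⟩
  -- members outside `S` are pairs
  have hout : ∀ f, f ∈ Finset.univ.image u → f ∉ S → f.card = 2 := by
    intro f hfu hfS
    have hle := card_le_two_of_mem_lowerFamily _ hlow (by omega) f hfu
    rcases Nat.lt_or_ge f.card 2 with hlt | hge
    · exfalso
      apply hfS
      rcases Nat.lt_or_ge f.card 1 with h0 | h1
      · rw [Finset.card_eq_zero.mp (show f.card = 0 by omega), hSdef]
        exact Finset.mem_insert_self _ _
      · obtain ⟨a, rfl⟩ := Finset.card_eq_one.mp (show f.card = 1 by omega)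
        rw [hSdef, Finset.mem_insert, Finset.mem_image]
        exact Or.inr ⟨a, Finset.mem_univ _, rfl⟩
    · omega
  -- the two extra faces
  have hdiff : (Finset.univ.image u \ S).card = 2 := by
    rw [Finset.card_sdiff_of_subset hsub, himg, hcard, hr]
    omega
  obtain ⟨e₁, e₂, hne, he⟩ := Finset.card_eq_two.mp hdiff
  have h1 : e₁ ∈ Finset.univ.image u \ S := by rw [he]; simp
  have h2 : e₂ ∈ Finset.univ.image u \ S := by rw [he]; simp
  rw [Finset.mem_sdiff] at h1 h2
  refine ⟨e₁, e₂, hne, hout e₁ h1.1 h1.2, hout e₂ h2.1 h2.2, ?_⟩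
  symm
  apply Finset.eq_of_subset_of_card_le
  · exact Finset.insert_subset h1.1 (Finset.insert_subset h2.1 hsub)
  · have he2 : e₂ ∉ S := h2.2
    have he1 : e₁ ∉ insert e₂ S := by rw [Finset.mem_insert, not_or]; exact ⟨hne, h1.2⟩
    rw [Finset.card_insert_of_notMem he1, Finset.card_insert_of_notMem he2, hcard, himg, hr]

/-- In a locked pair one side uses every coordinate (two unused coordinates would give two literal
classes of the common size `0`). -/
theorem full_or_full_of_locked {h r : ℕ} (u w : Fin r → Finset (Fin h))
    (hlk : ∀ (a c : Fin h) (β γ : Bool),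
      (Finset.univ.filter fun i => (a ∈ u i ↔ β = true)).card ≠
        (Finset.univ.filter fun j => (c ∈ w j ↔ γ = true)).card) :
    (∀ a : Fin h, ∃ i, a ∈ u i) ∨ (∀ c : Fin h, ∃ j, c ∈ w j) := by
  classical
  by_contra hno
  rw [not_or] at hno
  obtain ⟨h1, h2⟩ := hno
  push Not at h1 h2
  obtain ⟨a, ha⟩ := h1
  obtain ⟨c, hc⟩ := h2
  apply hlk a c true true
  have e1 : (Finset.univ.filter fun i => (a ∈ u i ↔ true = true)) = ∅ :=
    Finset.filter_false_of_mem fun i _ => by simp [ha i]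
  have e2 : (Finset.univ.filter fun j => (c ∈ w j ↔ true = true)) = ∅ :=
    Finset.filter_false_of_mem fun j _ => by simp [hc j]
  rw [e1, e2]

/-- The faces of a claw are `∅` and singletons. -/
theorem face_card_le_one_of_claw {h r : ℕ} (u : Fin r → Finset (Fin h))
    (hu : Function.Injective u) (hl : IsLowerSet (Set.range u))
    (hfull : ∀ a : Fin h, ∃ i, a ∈ u i) (hr : r = h + 1) (i : Fin r) : (u i).card ≤ 1 := by
  classical
  obtain ⟨hsub, hcard⟩ := claw_subset_image u hl hfull (by omega)
  have himg : (Finset.univ.image u).card = r := by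
    rw [Finset.card_image_of_injective _ hu, Finset.card_univ, Fintype.card_fin]
  have heq := Finset.eq_of_subset_of_card_le hsub (by rw [himg, hcard, hr])
  have hi : u i ∈ Finset.univ.image u := Finset.mem_image.mpr ⟨i, Finset.mem_univ _, rfl⟩
  rw [← heq, Finset.mem_insert, Finset.mem_image] at hi
  rcases hi with e | ⟨b, _, e⟩
  · rw [e]; simp
  · rw [← e]; simp

end Summit.ValiantsHypothesis.ValiantsHypothesis.Theorems.BarrierLever.FiniteCheck
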